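import Mathlib
import Literature.Computability.Complexity.ExtMonotoneCircuits
import Literature.Computability.Complexity.MonotoneSwitching
import Literature.Computability.Complexity.CliqueTestGraphs
import Literature.Computability.Complexity.RossmanMonotoneCliqueProb
import Summits.PneNP.PneNP.Theses.ConvexRankGates

/-!
# Sketch — first lemmas of three crux ideas for `CliqueExtLowerBound` (stmt-PneNP-10682)

Ideator 2, round 1. Nothing here is proved; every declaration is a `Prop` (or data used to
state one) over existing tree declarations, and the file must elaborate (`lean check` rc 0).

* Card A `event-sandwich-interpolation`: `GateInterpolates` (the per-gate interpolation
  property ICL on the referee pair) and `SandwichReduction` (ICL for every extended gate ⇒ the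
  crux's lower bound), plus `sandwichReduction_closes` (shape of the implication to the route decl).
* Card B `projection-universal-battlefield`: `CliquePadding`, `cspSatFn`, `CspToClique`.
* Card C `certificates-on-the-defect`: `CertificateLocalisation`.
-/

namespace Summit.PneNP.PneNP.Cruxes.CliqueExtLowerBound.Sketch

open scoped BigOperators Classical
open Finset Filter Literature.Computability.Complexity

noncomputable section

/-- Edge variables of `K_m`. -/
abbrev Edge (m : ℕ) : Type := (⊤ : SimpleGraph (Fin m)).edgeSet

/-! ### Card A — event-corrected CNF/DNF sandwiches -/

/-- A monomial (set of edges) touches fewer than `r` vertices (Jukna's legal length measure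
`μ` = number of touched vertices, Jukna 2012 §9.7). -/
def TouchesLT {m : ℕ} (r : ℕ) (R : Finset (Edge m)) : Prop :=
  ∃ T : Finset (Fin m), T.card < r ∧ ∀ e ∈ R, ∀ v ∈ (e : Sym2 (Fin m)), v ∈ T

/-- The negative test input `K_m ∖ E`: complement of the missing-edge indicator `y`. -/
def coGraph {m : ℕ} (y : Edge m → Bool) : Edge m → Bool := fun e => !(y e)

/-- Children data handed to a gate of fan-in `n` by the sandwich induction: a lower `r`-local
DNF and an upper `s`-local CNF per child with `dnf ≤ cnf` (tree: `ApproxInv.dnf_le_cnf`). -/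
structure ChildApprox (m n r s : ℕ) where
  dnf : Fin n → Finset (Finset (Edge m))
  cnf : Fin n → Finset (Finset (Edge m))
  width_dnf : ∀ i, ∀ R ∈ dnf i, TouchesLT r R
  width_cnf : ∀ i, ∀ S ∈ cnf i, S.card < s
  dnf_le_cnf : ∀ i x, EvalDNF (dnf i) x → EvalCNF (cnf i) x

/-- `Φ_D = φ(children's lower DNFs)`. -/
def lowerVal {m r s : ℕ} (g : GateFn) (ch : ChildApprox m g.1 r s) (x : Edge m → Bool) : Bool :=
  g.2 fun i => decide (EvalDNF (ch.dnf i) x)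

/-- `Φ_C = φ(children's upper CNFs)`. -/
def upperVal {m r s : ℕ} (g : GateFn) (ch : ChildApprox m g.1 r s) (x : Edge m → Bool) : Bool :=
  g.2 fun i => decide (EvalCNF (ch.cnf i) x)

/-- **ICL — the per-gate interpolation property on the referee pair.** For every tuple of
children pairs there are an `r`-local DNF `A ≤` an `s`-local CNF `B` such that
(P) at most an `ε`-fraction of the bare `k`-cliques `1_K` have `Φ_D(1_K) = 1` but `A(1_K) = 0`, and
(N) with probability `≤ ε` over the missing set `E ~ G(m, γ)` we have `Φ_C(K_m ∖ E) = 0` but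
`B(K_m ∖ E) = 1`. These are exactly the two event-valued corrections of the sandwich induction. -/
def GateInterpolates (g : GateFn) (m k r s : ℕ) (γ ε : ℝ) : Prop :=
  ∀ ch : ChildApprox m g.1 r s,
    ∃ A B : Finset (Finset (Edge m)),
      (∀ R ∈ A, TouchesLT r R) ∧ (∀ S ∈ B, S.card < s) ∧
      (∀ x, EvalDNF A x → EvalCNF B x) ∧
      (((univ : Finset (Finset (Fin m))).filter fun K => K.card = k ∧
            lowerVal g ch (cliqueVec K) = true ∧ ¬ EvalDNF A (cliqueVec K)).card : ℝ)
          ≤ ε * (m.choose k : ℝ) ∧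
      prob γ (fun y : Edge m → Bool =>
          upperVal g ch (coGraph y) = false ∧ EvalCNF B (coGraph y)) ≤ ε

/-- Missing-edge density of the referee negatives: `γ = 4 ln m / k`, `k = ⌈m^δ⌉`. -/
def gammaOf (δ : ℝ) (m : ℕ) : ℝ := 4 * Real.log m / (⌈(m : ℝ) ^ δ⌉₊ : ℝ)

/-- **Sandwich reduction (Card A's master lemma).** If for every `c` some CONSTANT localities
`r, s` make every extended gate of size parameter `m^c` interpolate with error `m^{-c-2}`, then
no `B_{m^c}`-circuit with `≤ m^c` gates computes `CLIQUE(m, ⌈m^δ⌉)` for large `m` — the body of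
`CliqueExtLowerBound` for this `δ` (fan-in of gates unrestricted, as in the crux). -/
def SandwichReduction : Prop :=
  ∀ δ : ℝ, 0 < δ → δ < 1 / 2 →
    (∀ c : ℕ, ∃ r s : ℕ, ∀ᶠ m : ℕ in atTop, ∀ g ∈ extGate (m ^ c),
        GateInterpolates g m ⌈(m : ℝ) ^ δ⌉₊ r s (gammaOf δ m) ((m : ℝ) ^ (-(c : ℝ) - 2))) →
    ∀ c : ℕ, ∀ᶠ m : ℕ in atTop, ∀ C : Circuit (Edge m),
      C.IsOver (extGate (m ^ c)) → C.size ≤ m ^ c → ¬ C.Computes (cliqueFn m ⌈(m : ℝ) ^ δ⌉₊)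

/-- The per-gate hypothesis of `SandwichReduction`, for one `δ`: the three single-gate lemmas
(CONV, PERM, GRANK; AND/OR is the tree's switching lemma) packaged as one statement. -/
def ExtGatesInterpolate (δ : ℝ) : Prop :=
  ∀ c : ℕ, ∃ r s : ℕ, ∀ᶠ m : ℕ in atTop, ∀ g ∈ extGate (m ^ c),
    GateInterpolates g m ⌈(m : ℝ) ^ δ⌉₊ r s (gammaOf δ m) ((m : ℝ) ^ (-(c : ℝ) - 2))

/-- How Card A concludes the crux BY NAME: the route decl `CliqueExtLowerBound` (whose inline
gate set is `extGate (m^c)` and whose inline clique function is `cliqueFn`, both up to unfolding)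
from the reduction and the per-gate lemmas at one `δ ∈ (0, 1/2)`. -/
def sandwichReduction_closes : Prop :=
  SandwichReduction → (∃ δ : ℝ, 0 < δ ∧ δ < 1 / 2 ∧ ExtGatesInterpolate δ) →
    Summit.PneNP.PneNP.Theses.ConvexRankGates.CliqueExtLowerBound

/-! ### Card B — projection universality: choose the battlefield -/

/-- **Padding.** `CLIQUE(M, K)` is a projection (variables or constants) of
`CLIQUE(M + a + b, K + a)`: add `a` universal and `b` isolated vertices. With it every pair
`(M, K)` polynomial in `N` embeds into the crux's diagonal family `(m, ⌈m^δ⌉)`. -/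
def CliquePadding : Prop :=
  ∀ M K a b : ℕ, ∃ π : Edge (M + a + b) → Edge M ⊕ Bool,
    ∀ x : Edge M → Bool, cliqueFn (M + a + b) (K + a) (fun e => Sum.elim x id (π e)) = cliqueFn M K x

/-- Monotone CSP satisfiability (the GGKS/GKRS `SAT_H`-type universal monotone-NP function):
inputs say which local assignments `α : Fin L` are ALLOWED at constraint `j : Fin N`; `Cons` is the
fixed consistency relation of the instance skeleton; accept iff some everywhere-allowed, pairwise
consistent choice exists. Monotone in the input. -/
def cspSatFn (N L : ℕ) (Cons : Fin N × Fin L → Fin N × Fin L → Prop) (u : Fin N × Fin L → Bool) :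
    Bool :=
  decide (∃ f : Fin N → Fin L, (∀ j, u (j, f j) = true) ∧ ∀ j j', j ≠ j' → Cons (j, f j) (j', f j'))

/-- **Karp as a monotone AND-projection.** `cspSatFn N L Cons` is obtained from
`CLIQUE(N·L, N)` by substituting for each edge variable either the AND of two input bits or the
constant `0` (vertices `(j, α)`; an edge between `(j, α)`, `(j', α')` with `j ≠ j'` consistent is
`u(j,α) ∧ u(j',α')`, every other edge is absent). AND₂ is in the basis, so `B_s`-circuit upper
bounds for CLIQUE transfer to every such family, and lower bounds transfer back. -/
def CspToClique : Prop :=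
  ∀ (N L : ℕ) (Cons : Fin N × Fin L → Fin N × Fin L → Prop),
    ∃ π : Edge (N * L) → ((Fin N × Fin L) × (Fin N × Fin L)) ⊕ Unit,
      ∀ u : Fin N × Fin L → Bool,
        cliqueFn (N * L) N (fun e => Sum.elim (fun ab => u ab.1 && u ab.2) (fun _ => false) (π e)) =
          cspSatFn N L Cons u

/-! ### Card C — CONV certificates localise on the defect -/

/-- **Certificate localisation.** For an SDP-feasibility gate `v ↦ [∃ Y ⪰ 0, tr(Aᵢ Y) ≤ bᵢ + (Bv)ᵢ]`
with `B ≥ 0`, a Farkas certificate `y ≥ 0`, `∑ yᵢ Aᵢ ⪰ 0`, `y·(b + Bv) < 0` of rejection at `v`,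
and any accepted `u`: (i) `y·(b + Bu) ≥ 0` (conic Yannakakis: it equals `tr((∑ yᵢAᵢ) Y_u)` plus a
nonnegative combination of constraint slacks); (ii) the functional `w = yᵀB ≥ 0` puts LESS weight
on the children alive at `v` but off at `u` than on the children on at `u` but dead at `v`;
(iii) hence the certificate slack is dominated by the weight of `on(u) ∩ dead(v)`. On the referee
pair `u = fire(K)`, `v = alive(E)`: certificates live on the sparse random defect. -/
def CertificateLocalisation : Prop :=
  ∀ (n p q : ℕ) (A : Fin p → Matrix (Fin q) (Fin q) ℝ) (b : Fin p → ℝ) (B : Fin p → Fin n → ℝ),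
    (∀ i j, 0 ≤ B i j) →
    ∀ y : Fin p → ℝ, (∀ i, 0 ≤ y i) → (∑ i, y i • A i).PosSemidef →
    ∀ u v : Fin n → Bool,
      (∃ Y : Matrix (Fin q) (Fin q) ℝ, Y.PosSemidef ∧
          ∀ i, (A i * Y).trace ≤ b i + ∑ j, B i j * (if u j then (1 : ℝ) else 0)) →
      (∑ i, y i * (b i + ∑ j, B i j * (if v j then (1 : ℝ) else 0)) < 0) →
      (0 ≤ ∑ i, y i * (b i + ∑ j, B i j * (if u j then (1 : ℝ) else 0))) ∧
      (∑ j ∈ univ.filter (fun j => v j = true ∧ u j = false), ∑ i, y i * B i j) <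
        (∑ j ∈ univ.filter (fun j => u j = true ∧ v j = false), ∑ i, y i * B i j) ∧
      (∑ i, y i * (b i + ∑ j, B i j * (if u j then (1 : ℝ) else 0))) ≤
        ∑ j ∈ univ.filter (fun j => u j = true ∧ v j = false), ∑ i, y i * B i j

end

end Summit.PneNP.PneNP.Cruxes.CliqueExtLowerBound.Sketch
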